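import Mathlib
import HarnessLib

/-!
# QUANT lane R8, front "FAR beyond trees", layer one — THE DEGREE-THREE GATE AT THE OBSERVER, LX: chart Q — the `nn`-FREE reformulation of the 8-cell statement

builds on p205010 (kernel theorem, internal audit signed; external expert review pending)

Support file (`--supports stmt-CriticalPhenomena-4575`), seat `prim-quant-p1` (gen 34); memo
`run/shared/lean/prim/quant/prim-quant-p1-g34/FOR-LEAD-GATE3-EDGE2.md` §3.  Mathlib only; standard axioms; no sorries; no definitions.
Statement text GENERATED by `kit/chartC/qspec.py` (cross-checked against the symbolic model `chartq.py`).

For fixed `(p, r₁, r₂)` the only `nn`-dependence of the 8-cell bad system `hred8 (p, r₁, r₂, nn)` (hypothesis `h8` of `Gate3.red_of_red8`) is in the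
last two forms: `g_S = α − nn·β` (non-increasing) and `E = γ + nn·δ` (non-decreasing), where `α, β, γ, δ` are linear in the eight cells with
coefficients polynomial in `(p, r₁, r₂)` and `β, δ ≥ 0` on non-negative cells.  Hence a bad point at some `nn ≥ 1` gives `α − β ≥ g_S > 0` and
`α·δ + β·γ = g_S·δ + β·E > 0` (strict because `δ ≥ (1 − (1−p)(1−r₁))·r₂·b1 > 0`: `b1 > 0` is forced by `g₁ > 0`).  So the **`nn`-free system**
(cells `≥ 0`, the six Harris rows, `g_v, g₁, g₂ > 0`, `α − β > 0` and the strict QUADRATIC `α δ + β γ > 0`) being infeasible at `(p, r₁, r₂)` implies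
`hred8 (p, r₁, r₂, nn)` for EVERY real `nn ≥ 1` at once: `Gate3.red8_of_chartQ`.  This removes the `(σ = nn·p, u = 1/nn)` pinch at
`(σ, u, r₁, r₂) = (1, 0, 0, 1)` of the chart-C box machine (memo §2): chart Q has three parameters and degree `(2,2,2)` generators, and its
box certificates are found by the kit down to the corner `(p, r₁, 1 − r₂) = (0, 0, 0)` (kit j252743).
[cite: KozmaNitzan2024, Conjecture 3 (p. 15)]; [this work].
-/

noncomputable section

namespace Summit.CriticalPhenomena.PercolationContinuityZ3.Theorems

namespace Quant

namespace Gate3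

set_option maxHeartbeats 1600000 in
/-- **Chart Q reduction.** If the `nn`-free system has no bad point at `(p, r₁, r₂)` (`0 < p ≤ 1`, `0 ≤ r₁ ≤ 1`, `0 < r₂ ≤ 1`), then the 8-cell
statement `hred8 (p, r₁, r₂, nn)` holds for every `nn ≥ 1`. [this work] -/
theorem red8_of_chartQ (p r₁ r₂ nn : ℝ) (hp0 : 0 < p) (hp1 : p ≤ 1) (hr10 : 0 ≤ r₁) (hr11 : r₁ ≤ 1) (hr20 : 0 < r₂) (hr21 : r₂ ≤ 1)
    (hn : 1 ≤ nn)
    (hQ : ∀ (a0 a1 a2 b1 b2 c0 c1 d : ℝ), 0 ≤ a0 → 0 ≤ a1 → 0 ≤ a2 → 0 ≤ b1 → 0 ≤ b2 → 0 ≤ c0 → 0 ≤ c1 → 0 ≤ d →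
      b1 * (b2 + (c0 + c1)) ≤ (a0 + a1 + a2) * d →
      b2 * (b1 + (c0 + c1)) ≤ (a0 + a1 + a2) * d →
      (c0 + c1) * (b1 + b2) ≤ (a0 + a1 + a2) * d →
      b1 * (a1 + a2 + c1 + d) ≤ d * (a0 + b1 + b2 + c0) →
      b2 * (a1 + a2 + c1 + d) ≤ d * (a0 + b1 + b2 + c0) →
      c0 * (a1 + a2 + c1 + d) ≤ (c1 + d) * (a0 + b1 + b2 + c0) →
      0 < p * ((1 - r₁) * (1 - r₂)) * (a0 + c0) - (1 - p) * a2 - (1 - p) * ((1 - r₁) * (1 - r₂)) * d →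
      0 < (1 - p) * (1 - r₁) * b1 - p * (r₂ * (1 - r₁)) * a0 - p * (1 - r₁) * a1 - (1 - p * r₁) * a2 - (1 - (1 - p) * (1 - r₂)) * (1 - r₁) * b2 - p * ((1 - r₁) * (1 - r₂)) * c1 →
      0 < (1 - p) * (1 - r₂) * b2 - p * (r₁ * (1 - r₂)) * a0 - p * (1 - r₂) * a1 - (1 - p * r₂) * a2 - (1 - (1 - p) * (1 - r₁)) * (1 - r₂) * b1 - p * ((1 - r₁) * (1 - r₂)) * c1 →
      0 < ((1 - p * max r₁ r₂) * a1 + (1 - p * (r₁ + r₂ * (1 - r₁))) * c1) - ((p * ((r₁ + r₂ * (1 - r₁)) - max r₁ r₂)) * a0 + (p * (1 - max r₁ r₂)) * a1 + ((1 - (1 - p) * (1 - r₁)) * (1 - r₂)) * b1 + ((1 - (1 - p) * (1 - r₂)) * (1 - r₁)) * b2 + (p * ((1 - r₁) * (1 - r₂))) * c1) →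
      0 < ((1 - p * max r₁ r₂) * a1 + (1 - p * (r₁ + r₂ * (1 - r₁))) * c1) * ((p * max r₁ r₂) * a0 + (p * max r₁ r₂) * a1 + 1 * a2 + ((1 - (1 - p) * (1 - r₁)) * r₂) * b1 + ((1 - (1 - p) * (1 - r₂)) * r₁) * b2 + (p * (r₁ + r₂ * (1 - r₁))) * c0 + (p * (r₁ + r₂ * (1 - r₁))) * c1 + 1 * d) + ((p * ((r₁ + r₂ * (1 - r₁)) - max r₁ r₂)) * a0 + (p * (1 - max r₁ r₂)) * a1 + ((1 - (1 - p) * (1 - r₁)) * (1 - r₂)) * b1 + ((1 - (1 - p) * (1 - r₂)) * (1 - r₁)) * b2 + (p * ((1 - r₁) * (1 - r₂))) * c1) * ((p * (1 + r₁ + r₂) - 2) * a0 + (p * (1 + r₁ + r₂) - p * max r₁ r₂ - 1) * a1 + (p * (1 + r₁ + r₂) - 2) * a2 + ((1 - (1 - p) * (1 - r₁)) * (1 + r₂) - 1) * b1 + ((1 - (1 - p) * (1 - r₂)) * (1 + r₁) - 1) * b2 + (p * (1 + 2 * (r₁ + r₂ * (1 - r₁))) - 2) * c0 + (p * (1 +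 (r₁ + r₂ * (1 - r₁))) - 1) * c1 + (1 - (1 - p) * ((1 - r₁) * (1 - r₂))) * d) →
      False) :
    ∀ (a0 a1 a2 b1 b2 c0 c1 d : ℝ), 0 ≤ a0 → 0 ≤ a1 → 0 ≤ a2 → 0 ≤ b1 → 0 ≤ b2 → 0 ≤ c0 → 0 ≤ c1 → 0 ≤ d →
    b1 * (b2 + (c0 + c1)) ≤ (a0 + a1 + a2) * d →
    b2 * (b1 + (c0 + c1)) ≤ (a0 + a1 + a2) * d →
    (c0 + c1) * (b1 + b2) ≤ (a0 + a1 + a2) * d →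
    b1 * (a1 + a2 + c1 + d) ≤ d * (a0 + b1 + b2 + c0) →
    b2 * (a1 + a2 + c1 + d) ≤ d * (a0 + b1 + b2 + c0) →
    c0 * (a1 + a2 + c1 + d) ≤ (c1 + d) * (a0 + b1 + b2 + c0) →
    0 < p * ((1 - r₁) * (1 - r₂)) * (a0 + c0) - (1 - p) * a2 - (1 - p) * ((1 - r₁) * (1 - r₂)) * d →
    0 < (1 - p) * (1 - r₁) * b1 - p * (r₂ * (1 - r₁)) * a0 - p * (1 - r₁) * a1 - (1 - p * r₁) * a2 - (1 - (1 - p) * (1 - r₂)) * (1 - r₁) * b2 - p * ((1 - r₁) * (1 - r₂)) * c1 →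
    0 < (1 - p) * (1 - r₂) * b2 - p * (r₁ * (1 - r₂)) * a0 - p * (1 - r₂) * a1 - (1 - p * r₂) * a2 - (1 - (1 - p) * (1 - r₁)) * (1 - r₂) * b1 - p * ((1 - r₁) * (1 - r₂)) * c1 →
    0 < (1 - p * max r₁ r₂ - nn * p * (1 - max r₁ r₂)) * a1 + (1 - p * (r₁ + r₂ * (1 - r₁)) - nn * p * ((1 - r₁) * (1 - r₂))) * c1 - nn * p * (r₁ + r₂ * (1 - r₁) - max r₁ r₂) * a0 - nn * ((1 - (1 - p) * (1 - r₁)) * (1 - r₂)) * b1 - nn * ((1 - (1 - p) * (1 - r₂)) * (1 - r₁)) * b2 →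
    0 < (p * (1 + r₁ + r₂ + nn * max r₁ r₂) - 2) * a0 + (p * (1 + r₁ + r₂) + p * max r₁ r₂ * (nn - 1) - 1) * a1 + (p * (1 + r₁ + r₂) + nn - 2) * a2 + ((1 - (1 - p) * (1 - r₁)) * (1 + r₂ * (nn + 1)) - 1) * b1 + ((1 - (1 - p) * (1 - r₂)) * (1 + r₁ * (nn + 1)) - 1) * b2 + (p * (1 + (nn + 2) * (r₁ + r₂ * (1 - r₁))) - 2) * c0 + (p * (1 + (nn + 1) * (r₁ + r₂ * (1 - r₁))) - 1) * c1 + (nn + 1 - (1 - p) * ((1 - r₁) * (1 - r₂))) * d →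
    False := by
  intro a0 a1 a2 b1 b2 c0 c1 d ha0 ha1 ha2 hb1 hb2 hc0 hc1 hd hU1 hU2 hU3 hK1 hK2 hK3 hV hG1 hG2 hS hE
  have hrb0 : 0 ≤ max r₁ r₂ := le_max_of_le_left hr10
  have hrb1 : max r₁ r₂ ≤ 1 := max_le hr11 hr21
  have hrho : max r₁ r₂ ≤ r₁ + r₂ * (1 - r₁) := by
    rcases le_total r₁ r₂ with h | h
    · rw [max_eq_right h]; nlinarith only [h, hr10, hr21]
    · rw [max_eq_left h]; nlinarith only [hr20, hr11]
  have hW12 : 0 ≤ (1 - r₁) * (1 - r₂) := mul_nonneg (sub_nonneg.2 hr11) (sub_nonneg.2 hr21)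
  have hs1 : 0 < 1 - (1 - p) * (1 - r₁) := by nlinarith only [hp0, hr10, hr11, hp1]
  have hs2 : 0 ≤ 1 - (1 - p) * (1 - r₂) := by nlinarith only [hp0, hr20, hr21, hp1]
  have hrho0 : 0 ≤ r₁ + r₂ * (1 - r₁) := by nlinarith only [hr10, hr20, hr11]
  -- β ≥ 0
  have hβ0 : 0 ≤ (p * ((r₁ + r₂ * (1 - r₁)) - max r₁ r₂)) * a0 + (p * (1 - max r₁ r₂)) * a1 + ((1 - (1 - p) * (1 - r₁)) * (1 - r₂)) * b1 + ((1 - (1 - p) * (1 - r₂)) * (1 - r₁)) * b2 + (p * ((1 - r₁) * (1 - r₂))) * c1 := by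
    have t1 : 0 ≤ p * ((r₁ + r₂ * (1 - r₁)) - max r₁ r₂) * a0 := mul_nonneg (mul_nonneg hp0.le (sub_nonneg.2 hrho)) ha0
    have t2 : 0 ≤ p * (1 - max r₁ r₂) * a1 := mul_nonneg (mul_nonneg hp0.le (sub_nonneg.2 hrb1)) ha1
    have t3 : 0 ≤ (1 - (1 - p) * (1 - r₁)) * (1 - r₂) * b1 := mul_nonneg (mul_nonneg hs1.le (sub_nonneg.2 hr21)) hb1
    have t4 : 0 ≤ (1 - (1 - p) * (1 - r₂)) * (1 - r₁) * b2 := mul_nonneg (mul_nonneg hs2 (sub_nonneg.2 hr11)) hb2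
    have t5 : 0 ≤ p * ((1 - r₁) * (1 - r₂)) * c1 := mul_nonneg (mul_nonneg hp0.le hW12) hc1
    linarith
  -- b1 > 0 from g₁ > 0, hence δ > 0
  have hb1pos : 0 < b1 := by
    by_contra hcon
    have hb10 : b1 = 0 := le_antisymm (not_lt.mp hcon) hb1
    rw [hb10] at hG1
    have t1 : 0 ≤ p * (r₂ * (1 - r₁)) * a0 := mul_nonneg (mul_nonneg hp0.le (mul_nonneg hr20.le (sub_nonneg.2 hr11))) ha0
    have t2 : 0 ≤ p * (1 - r₁) * a1 := mul_nonneg (mul_nonneg hp0.le (sub_nonneg.2 hr11)) ha1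
    have t3 : 0 ≤ (1 - p * r₁) * a2 := mul_nonneg (by nlinarith only [hp1, hr11, hp0, hr10]) ha2
    have t4 : 0 ≤ (1 - (1 - p) * (1 - r₂)) * (1 - r₁) * b2 := mul_nonneg (mul_nonneg hs2 (sub_nonneg.2 hr11)) hb2
    have t5 : 0 ≤ p * ((1 - r₁) * (1 - r₂)) * c1 := mul_nonneg (mul_nonneg hp0.le hW12) hc1
    linarith
  have hδpos : 0 < (p * max r₁ r₂) * a0 + (p * max r₁ r₂) * a1 + 1 * a2 + ((1 - (1 - p) * (1 - r₁)) * r₂) * b1 + ((1 - (1 - p) * (1 - r₂)) * r₁) * b2 + (p * (r₁ + r₂ * (1 - r₁))) * c0 + (p * (r₁ + r₂ * (1 - r₁))) * c1 + 1 * d := by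
    have t0 : 0 < (1 - (1 - p) * (1 - r₁)) * r₂ * b1 := mul_pos (mul_pos hs1 hr20) hb1pos
    have t1 : 0 ≤ p * max r₁ r₂ * a0 := mul_nonneg (mul_nonneg hp0.le hrb0) ha0
    have t2 : 0 ≤ p * max r₁ r₂ * a1 := mul_nonneg (mul_nonneg hp0.le hrb0) ha1
    have t4 : 0 ≤ (1 - (1 - p) * (1 - r₂)) * r₁ * b2 := mul_nonneg (mul_nonneg hs2 hr10) hb2
    have t5 : 0 ≤ p * (r₁ + r₂ * (1 - r₁)) * c0 := mul_nonneg (mul_nonneg hp0.le hrho0) hc0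
    have t6 : 0 ≤ p * (r₁ + r₂ * (1 - r₁)) * c1 := mul_nonneg (mul_nonneg hp0.le hrho0) hc1
    nlinarith [ha2, hd]
  -- g_S = α - nn β, E = γ + nn δ
  have eS : (1 - p * max r₁ r₂ - nn * p * (1 - max r₁ r₂)) * a1 + (1 - p * (r₁ + r₂ * (1 - r₁)) - nn * p * ((1 - r₁) * (1 - r₂))) * c1 - nn * p * (r₁ + r₂ * (1 - r₁) - max r₁ r₂) * a0 - nn * ((1 - (1 - p) * (1 - r₁)) * (1 - r₂)) * b1 - nn * ((1 - (1 - p) * (1 - r₂)) * (1 - r₁)) * b2 = ((1 - p * max r₁ r₂) * a1 + (1 - p * (r₁ + r₂ * (1 - r₁))) * c1) - nn * ((p * ((r₁ + r₂ * (1 - r₁)) - max r₁ r₂)) * a0 + (p * (1 - max r₁ r₂)) * a1 + ((1 - (1 - p) * (1 - r₁)) * (1 - r₂)) * b1 + ((1 - (1 - p) * (1 - r₂)) * (1 - r₁)) * b2 + (p * ((1 - r₁) * (1 - r₂))) * c1) := by ring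
  have eE : (p * (1 + r₁ + r₂ + nn * max r₁ r₂) - 2) * a0 + (p * (1 + r₁ + r₂) + p * max r₁ r₂ * (nn - 1) - 1) * a1 + (p * (1 + r₁ + r₂) + nn - 2) * a2 + ((1 - (1 - p) * (1 - r₁)) * (1 + r₂ * (nn + 1)) - 1) * b1 + ((1 - (1 - p) * (1 - r₂)) * (1 + r₁ * (nn + 1)) - 1) * b2 + (p * (1 + (nn + 2) * (r₁ + r₂ * (1 - r₁))) - 2) * c0 + (p * (1 + (nn + 1) * (r₁ + r₂ * (1 - r₁))) - 1) * c1 + (nn + 1 - (1 - p) * ((1 - r₁) * (1 - r₂))) * d = ((p * (1 + r₁ + r₂) - 2) * a0 + (p * (1 + r₁ + r₂) - p * max r₁ r₂ - 1) * a1 + (p * (1 + r₁ + r₂) - 2) * a2 + ((1 - (1 - p) * (1 - r₁)) * (1 + r₂) - 1) * b1 + ((1 - (1 - p) * (1 - r₂)) * (1 + r₁) - 1) * b2 + (p * (1 + 2 * (r₁ + r₂ * (1 - r₁))) - 2) * c0 + (p * (1 + (r₁ + r₂ * (1 - r₁))) - 1) * c1 + (1 - (1 - p) * ((1 - r₁)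 * (1 - r₂))) * d) + nn * ((p * max r₁ r₂) * a0 + (p * max r₁ r₂) * a1 + 1 * a2 + ((1 - (1 - p) * (1 - r₁)) * r₂) * b1 + ((1 - (1 - p) * (1 - r₂)) * r₁) * b2 + (p * (r₁ + r₂ * (1 - r₁))) * c0 + (p * (r₁ + r₂ * (1 - r₁))) * c1 + 1 * d) := by ring
  rw [eS] at hS; rw [eE] at hE
  have h1 : 0 < ((1 - p * max r₁ r₂) * a1 + (1 - p * (r₁ + r₂ * (1 - r₁))) * c1) - ((p * ((r₁ + r₂ * (1 - r₁)) - max r₁ r₂)) * a0 + (p * (1 - max r₁ r₂)) * a1 + ((1 - (1 - p) * (1 - r₁)) * (1 - r₂)) * b1 + ((1 - (1 - p) * (1 - r₂)) * (1 - r₁)) * b2 + (p * ((1 - r₁) * (1 - r₂))) * c1) := by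
    have e : ((1 - p * max r₁ r₂) * a1 + (1 - p * (r₁ + r₂ * (1 - r₁))) * c1) - ((p * ((r₁ + r₂ * (1 - r₁)) - max r₁ r₂)) * a0 + (p * (1 - max r₁ r₂)) * a1 + ((1 - (1 - p) * (1 - r₁)) * (1 - r₂)) * b1 + ((1 - (1 - p) * (1 - r₂)) * (1 - r₁)) * b2 + (p * ((1 - r₁) * (1 - r₂))) * c1) = (((1 - p * max r₁ r₂) * a1 + (1 - p * (r₁ + r₂ * (1 - r₁))) * c1) - nn * ((p * ((r₁ + r₂ * (1 - r₁)) - max r₁ r₂)) * a0 + (p * (1 - max r₁ r₂)) * a1 + ((1 - (1 - p) * (1 - r₁)) * (1 - r₂)) * b1 + ((1 - (1 - p) * (1 - r₂)) * (1 - r₁)) * b2 + (p * ((1 - r₁) * (1 - r₂))) * c1)) + (nn - 1) * ((p * ((r₁ + r₂ * (1 - r₁)) - max r₁ r₂)) * a0 + (p * (1 - max r₁ r₂)) * a1 + ((1 - (1 - p) * (1 - r₁)) * (1 - r₂)) * b1 + ((1 - (1 - p) * (1 - r₂)) * (1 - r₁)) * b2 + (p * ((1 - r₁) * (1 - r₂)))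 * c1) := by ring
    rw [e]; exact add_pos_of_pos_of_nonneg hS (mul_nonneg (by linarith) hβ0)
  have h2 : 0 < ((1 - p * max r₁ r₂) * a1 + (1 - p * (r₁ + r₂ * (1 - r₁))) * c1) * ((p * max r₁ r₂) * a0 + (p * max r₁ r₂) * a1 + 1 * a2 + ((1 - (1 - p) * (1 - r₁)) * r₂) * b1 + ((1 - (1 - p) * (1 - r₂)) * r₁) * b2 + (p * (r₁ + r₂ * (1 - r₁))) * c0 + (p * (r₁ + r₂ * (1 - r₁))) * c1 + 1 * d) + ((p * ((r₁ + r₂ * (1 - r₁)) - max r₁ r₂)) * a0 + (p * (1 - max r₁ r₂)) * a1 + ((1 - (1 - p) * (1 - r₁)) * (1 - r₂)) * b1 + ((1 - (1 - p) * (1 - r₂)) * (1 - r₁)) * b2 + (p * ((1 - r₁) * (1 - r₂))) * c1) * ((p * (1 + r₁ + r₂) - 2) * a0 + (p * (1 + r₁ + r₂) - p * max r₁ r₂ - 1) * a1 + (p * (1 + r₁ + r₂) - 2) * a2 + ((1 - (1 - p) * (1 - r₁)) * (1 + r₂) - 1) * b1 + ((1 - (1 - p) * (1 - r₂)) * (1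 + r₁) - 1) * b2 + (p * (1 + 2 * (r₁ + r₂ * (1 - r₁))) - 2) * c0 + (p * (1 + (r₁ + r₂ * (1 - r₁))) - 1) * c1 + (1 - (1 - p) * ((1 - r₁) * (1 - r₂))) * d) := by
    have e : ((1 - p * max r₁ r₂) * a1 + (1 - p * (r₁ + r₂ * (1 - r₁))) * c1) * ((p * max r₁ r₂) * a0 + (p * max r₁ r₂) * a1 + 1 * a2 + ((1 - (1 - p) * (1 - r₁)) * r₂) * b1 + ((1 - (1 - p) * (1 - r₂)) * r₁) * b2 + (p * (r₁ + r₂ * (1 - r₁))) * c0 + (p * (r₁ + r₂ * (1 - r₁))) * c1 + 1 * d) + ((p * ((r₁ + r₂ * (1 - r₁)) - max r₁ r₂)) * a0 + (p * (1 - max r₁ r₂)) * a1 + ((1 - (1 - p) * (1 - r₁)) * (1 - r₂)) * b1 + ((1 - (1 - p) * (1 - r₂)) * (1 - r₁)) * b2 + (p * ((1 - r₁) * (1 - r₂))) * c1) * ((p * (1 + r₁ + r₂) - 2) * a0 + (p * (1 + r₁ + r₂) - p * max r₁ r₂ - 1) * a1 + (p * (1 + r₁ + r₂) - 2) * a2 +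 ((1 - (1 - p) * (1 - r₁)) * (1 + r₂) - 1) * b1 + ((1 - (1 - p) * (1 - r₂)) * (1 + r₁) - 1) * b2 + (p * (1 + 2 * (r₁ + r₂ * (1 - r₁))) - 2) * c0 + (p * (1 + (r₁ + r₂ * (1 - r₁))) - 1) * c1 + (1 - (1 - p) * ((1 - r₁) * (1 - r₂))) * d) = (((1 - p * max r₁ r₂) * a1 + (1 - p * (r₁ + r₂ * (1 - r₁))) * c1) - nn * ((p * ((r₁ + r₂ * (1 - r₁)) - max r₁ r₂)) * a0 + (p * (1 - max r₁ r₂)) * a1 + ((1 - (1 - p) * (1 - r₁)) * (1 - r₂)) * b1 + ((1 - (1 - p) * (1 - r₂)) * (1 - r₁)) * b2 + (p * ((1 - r₁) * (1 - r₂))) * c1)) * ((p * max r₁ r₂) * a0 + (p * max r₁ r₂) * a1 + 1 * a2 + ((1 - (1 - p) * (1 - r₁)) * r₂) * b1 + ((1 - (1 - p) * (1 - r₂)) * r₁) * b2 + (p * (r₁ + r₂ * (1 - r₁))) * c0 + (p * (r₁ + r₂ * (1 - r₁))) * c1 + 1 * d) + ((p * ((r₁ + r₂ * (1 - r₁)) -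 max r₁ r₂)) * a0 + (p * (1 - max r₁ r₂)) * a1 + ((1 - (1 - p) * (1 - r₁)) * (1 - r₂)) * b1 + ((1 - (1 - p) * (1 - r₂)) * (1 - r₁)) * b2 + (p * ((1 - r₁) * (1 - r₂))) * c1) * (((p * (1 + r₁ + r₂) - 2) * a0 + (p * (1 + r₁ + r₂) - p * max r₁ r₂ - 1) * a1 + (p * (1 + r₁ + r₂) - 2) * a2 + ((1 - (1 - p) * (1 - r₁)) * (1 + r₂) - 1) * b1 + ((1 - (1 - p) * (1 - r₂)) * (1 + r₁) - 1) * b2 + (p * (1 + 2 * (r₁ + r₂ * (1 - r₁))) - 2) * c0 + (p * (1 + (r₁ + r₂ * (1 - r₁))) - 1) * c1 + (1 - (1 - p) * ((1 - r₁) * (1 - r₂))) * d) + nn * ((p * max r₁ r₂) * a0 + (p * max r₁ r₂) * a1 + 1 * a2 + ((1 - (1 - p) * (1 - r₁)) * r₂) * b1 + ((1 - (1 - p) * (1 - r₂)) * r₁) * b2 + (p * (r₁ + r₂ * (1 - r₁))) * c0 + (p * (r₁ + r₂ * (1 - r₁))) * c1 + 1 * d)) := by ring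
    rw [e]; exact add_pos_of_pos_of_nonneg (mul_pos hS hδpos) (mul_nonneg hβ0 hE.le)
  exact hQ a0 a1 a2 b1 b2 c0 c1 d ha0 ha1 ha2 hb1 hb2 hc0 hc1 hd hU1 hU2 hU3 hK1 hK2 hK3 hV hG1 hG2 h1 h2

end Gate3

end Quant

end Summit.CriticalPhenomena.PercolationContinuityZ3.Theorems
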